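import Summits.QuantumFields.YangMills.Theorems.FluctuationComparisonRegPrIntLS1aFibreOpenPlaquette
import Summits.QuantumFields.YangMills.Theorems.FluctuationComparisonRegPrIntLWregCentralBondPlaquetteLetters
import HarnessLib

/-!
# The centre leg is off every plaquette through the central crossing bond; the central-edge plaquette openness without lattice hypotheses

This file discharges the two lattice side conditions `hfree`, `hleg` of
`FluctuationComparisonRegPrIntLS1aFibreOpenPlaquette.plaqHol_fibre_locally_onto` (the `(T⊥)(iii)`-small openness of a central-edge plaquette
holonomy along the `(0.4)` fibres), in the standing range `j + 1 ≤ m + K`, odd `L ≥ 3`, `h = (L−1)∕2`: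

* `hfree` («a plaquette has at most one central crossing bond») is ALREADY in the tree —
  `WregCentralBondPlaquetteLetters.eq_of_centralBond_mem_plaqBonds` (seat px21) — and is imported, not restated;
* §1 `centreLeg_not_mem_edges` (new) — for `ν ≠ c₀.dir` the centre leg `⟨emb c₀₋, ν⟩` is none of the four edges of a plaquette through
  `β(c₀)`: the two edges parallel to `β(c₀)` have direction `c₀.dir ≠ ν`, and the sources of the two perpendicular ones have `c₀.dir`-coordinate
  `emb c₀₋ + h` or `emb c₀₋ + h + 1`, never `emb c₀₋` (`0 < h < h + 1 < L` and `WregCentralBondPlaquetteLetters.false_of_emb_add_eq`);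
* §2 `plaqHol_fibre_locally_onto'` — the plaquette openness theorem with both lattice hypotheses removed.

Bookkeeping over landed theorems; nothing of Bałaban's is formalised here beyond what the imported files cite. This does NOT prove (T⊥)'s
consumers, `FluctuationComparisonRegPrIntL`, or `YM3TorusSU2`; rung R3 = `SU(2)` YM₃ on `T³` only.
-/

set_option autoImplicit false

noncomputable section

open scoped Matrix.Norms.L2Operator Topology
open Filter Function

namespace Summit.QuantumFields.YangMills.Theorems.FluctuationComparisonRegPrIntLS1aCentralEdgeGeometry

open Literature.MathematicalPhysics.QuantumFieldTheory.Balaban1983to89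
open T4Continuum AveragingRT BlockAveraging ExpMeanLog BlockAveragingHaarAC
open Summit.QuantumFields.YangMills.Theorems.FluctuationComparisonRegPrIntLS1aCentreLegOccurrence
open Summit.QuantumFields.YangMills.Theorems.FluctuationComparisonRegPrIntLS1aFibreOpenMember
open Summit.QuantumFields.YangMills.Theorems.FluctuationComparisonRegPrIntLS1aFibreOpenPlaquette
open Summit.QuantumFields.YangMills.Theorems.WregCentralBondPlaquetteLetters (apply_eq_of_centralBond_eq eq_of_centralBond_mem_plaqBonds
  shift_apply_self shift_apply_of_ne)
open Literature.MathematicalPhysics.QuantumFieldTheory.Balaban1983to89.B14.Eq12InteriorLocality (plaqBonds mem_plaqBonds)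

variable {P : Params} {j : ℕ}

/-! ## §1 The centre leg of `c₀` is not an edge of a plaquette through `β(c₀)` -/

/-- **THE CENTRE LEG IS OFF THE PLAQUETTE**: if `β(c₀)` is an edge of `p` and `ν ≠ c₀.dir`, the centre leg `⟨emb c₀₋, ν⟩` is none of the four
edges of `p`: the two edges parallel to `β(c₀)` have the wrong direction, and the sources of the two perpendicular ones sit at `c₀.dir`-residue
`h` or `h + 1` off the block centre `emb c₀₋`. [folklore] -/
theorem centreLeg_not_mem_edges (hj : j + 1 ≤ P.m + P.K) (p : Plaq P j) (c₀ : PBond P (j + 1)) {ν : Fin P.d} (hν : ν ≠ c₀.dir)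
    (hβ : centralBond c₀ = ⟨p.src, p.μ⟩ ∨ centralBond c₀ = ⟨p.src.shift p.μ, p.ν⟩ ∨ centralBond c₀ = ⟨p.src.shift p.ν, p.μ⟩ ∨
      centralBond c₀ = ⟨p.src, p.ν⟩) :
    (⟨emb c₀.src, ν⟩ : PBond P j) ≠ ⟨p.src, p.μ⟩ ∧ (⟨emb c₀.src, ν⟩ : PBond P j) ≠ ⟨p.src.shift p.μ, p.ν⟩ ∧
      (⟨emb c₀.src, ν⟩ : PBond P j) ≠ ⟨p.src.shift p.ν, p.μ⟩ ∧ (⟨emb c₀.src, ν⟩ : PBond P j) ≠ ⟨p.src, p.ν⟩ := by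
  have hL := two_mul_half_add_one P
  have hL1 := P.hL.2
  have hμν : p.μ ≠ p.ν := ne_of_lt p.hμν
  have hνμ : p.ν ≠ p.μ := hμν.symm
  have hh1 : 1 ≤ (P.L - 1) / 2 := by omega
  have hhL : (P.L - 1) / 2 + 1 < P.L := by omega
  have A := fun {s : Site P j} {dir : Fin P.d} (h : centralBond c₀ = ⟨s, dir⟩) (κ : Fin P.d) => apply_eq_of_centralBond_eq h κ
  -- source and direction of a hypothetical coincidence
  have X : ∀ {s : Site P j} {dir : Fin P.d}, (⟨emb c₀.src, ν⟩ : PBond P j) = ⟨s, dir⟩ → (∀ κ, emb c₀.src κ = s κ) ∧ ν = dir :=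
    fun hE => ⟨fun κ => congrFun (PBond.mk.injEq _ _ _ _ ▸ hE :).1 κ, (PBond.mk.injEq _ _ _ _ ▸ hE :).2⟩
  refine ⟨fun hE => ?_, fun hE => ?_, fun hE => ?_, fun hE => ?_⟩ <;> obtain ⟨E, hd⟩ := X hE <;>
    rcases hβ with h1 | h1 | h1 | h1
  -- edge 1 `⟨x, μ⟩`: `ν = μ`
  · exact hν (hd.trans (A h1 p.μ).1.symm)
  · obtain ⟨-, e1⟩ := A h1 p.ν; have E' := E p.ν
    rw [if_pos rfl, shift_apply_of_ne _ hνμ] at e1; rw [e1] at E'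
    exact WregCentralBondPlaquetteLetters.false_of_emb_add_eq hj (y := c₀.src) (y' := c₀.src) (ν := p.ν) (r := 0)
      (r' := (((P.L - 1) / 2 : ℕ) : ℤ)) (by push_cast at E' ⊢; linear_combination E') (by omega) (by omega) (by omega)
  · exact hν (hd.trans (A h1 p.μ).1.symm)
  · obtain ⟨-, e1⟩ := A h1 p.ν; have E' := E p.ν
    rw [if_pos rfl] at e1; rw [e1] at E'
    exact WregCentralBondPlaquetteLetters.false_of_emb_add_eq hj (y := c₀.src) (y' := c₀.src) (ν := p.ν) (r := 0)
      (r' := (((P.L - 1) / 2 : ℕ) : ℤ)) (by push_cast at E' ⊢; linear_combination E') (by omega) (by omega) (by omega)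
  -- edge 2 `⟨x + e_μ, ν⟩`: `ν = p.ν`
  · obtain ⟨-, e1⟩ := A h1 p.μ; have E' := E p.μ
    rw [if_pos rfl] at e1; rw [shift_apply_self, e1] at E'
    exact WregCentralBondPlaquetteLetters.false_of_emb_add_eq hj (y := c₀.src) (y' := c₀.src) (ν := p.μ) (r := 0)
      (r' := (((P.L - 1) / 2 : ℕ) : ℤ) + 1) (by push_cast at E' ⊢; linear_combination E') (by omega) (by omega) (by omega)
  · exact hν (hd.trans (A h1 p.μ).1.symm)
  · obtain ⟨-, e1⟩ := A h1 p.μ; have E' := E p.μ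
    rw [if_pos rfl, shift_apply_of_ne _ hμν] at e1; rw [shift_apply_self, e1] at E'
    exact WregCentralBondPlaquetteLetters.false_of_emb_add_eq hj (y := c₀.src) (y' := c₀.src) (ν := p.μ) (r := 0)
      (r' := (((P.L - 1) / 2 : ℕ) : ℤ) + 1) (by push_cast at E' ⊢; linear_combination E') (by omega) (by omega) (by omega)
  · exact hν (hd.trans (A h1 p.μ).1.symm)
  -- edge 3 `⟨x + e_ν, μ⟩`: `ν = μ`
  · exact hν (hd.trans (A h1 p.μ).1.symm)
  · obtain ⟨-, e1⟩ := A h1 p.ν; have E' := E p.ν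
    rw [if_pos rfl, shift_apply_of_ne _ hνμ] at e1; rw [shift_apply_self, e1] at E'
    exact WregCentralBondPlaquetteLetters.false_of_emb_add_eq hj (y := c₀.src) (y' := c₀.src) (ν := p.ν) (r := 0)
      (r' := (((P.L - 1) / 2 : ℕ) : ℤ) + 1) (by push_cast at E' ⊢; linear_combination E') (by omega) (by omega) (by omega)
  · exact hν (hd.trans (A h1 p.μ).1.symm)
  · obtain ⟨-, e1⟩ := A h1 p.ν; have E' := E p.ν
    rw [if_pos rfl] at e1; rw [shift_apply_self, e1] at E'
    exact WregCentralBondPlaquetteLetters.false_of_emb_add_eq hj (y := c₀.src) (y' := c₀.src) (ν := p.ν) (r := 0)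
      (r' := (((P.L - 1) / 2 : ℕ) : ℤ) + 1) (by push_cast at E' ⊢; linear_combination E') (by omega) (by omega) (by omega)
  -- edge 4 `⟨x, ν⟩`: `ν = p.ν`
  · obtain ⟨-, e1⟩ := A h1 p.μ; have E' := E p.μ
    rw [if_pos rfl] at e1; rw [e1] at E'
    exact WregCentralBondPlaquetteLetters.false_of_emb_add_eq hj (y := c₀.src) (y' := c₀.src) (ν := p.μ) (r := 0)
      (r' := (((P.L - 1) / 2 : ℕ) : ℤ)) (by push_cast at E' ⊢; linear_combination E') (by omega) (by omega) (by omega)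
  · exact hν (hd.trans (A h1 p.μ).1.symm)
  · obtain ⟨-, e1⟩ := A h1 p.μ; have E' := E p.μ
    rw [if_pos rfl, shift_apply_of_ne _ hμν] at e1; rw [e1] at E'
    exact WregCentralBondPlaquetteLetters.false_of_emb_add_eq hj (y := c₀.src) (y' := c₀.src) (ν := p.μ) (r := 0)
      (r' := (((P.L - 1) / 2 : ℕ) : ℤ)) (by push_cast at E' ⊢; linear_combination E') (by omega) (by omega) (by omega)
  · exact hν (hd.trans (A h1 p.μ).1.symm)

/-! ## §2 The hypothesis-free central-edge plaquette theorem -/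

/-- **CENTRAL-EDGE PLAQUETTES: `U(∂p)` IS OPEN ALONG THE `(0.4)` FIBRES AT SMALL FIELDS — lattice side conditions discharged.**  This is
`plaqHol_fibre_locally_onto` of the plaquette file with its two lattice hypotheses (`hfree`: at most one central edge; `hleg`: the centre leg is
off the plaquette) supplied by `WregCentralBondPlaquetteLetters.eq_of_centralBond_mem_plaqBonds` and §1: for `SU(2)`, small plaquettes, a plaquette `p` having the central crossing bond `β(c₀)` as an edge, a
direction `ν ≠ c₀.dir` with the numerical side conditions of the centre-leg engine, and every `ε > 0`, all values `x` with `x·U(∂p)⁻¹`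
close to `1` are attained as `U′(∂p)` by fields `U′` that are `ε`-close to `U` bondwise and have the same block averages `𝒰(0.4)`.
[cite: Balaban1987RG1, (0.4) p.253; Balaban1985Averaging, (1)-(4) pp.17-18; folklore] -/
theorem plaqHol_fibre_locally_onto' (hj : j + 1 ≤ P.m + P.K) {δ₁ : ℝ} (hδ : 0 ≤ δ₁)
    (hτ : ((((P.d + 2) * P.L : ℕ) : ℝ) ^ 2 / 4) * δ₁ < deltaSU (Fin 2))
    (U : GaugeField P j (Matrix.specialUnitaryGroup (Fin 2) ℂ)) (hU : PlaqSmall δ₁ U)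
    (c₀ : PBond P (j + 1)) {ν : Fin P.d} (hν : ν ≠ c₀.dir) (p : Plaq P j)
    (hβ : centralBond c₀ = ⟨p.src, p.μ⟩ ∨ centralBond c₀ = ⟨p.src.shift p.μ, p.ν⟩ ∨ centralBond c₀ = ⟨p.src.shift p.ν, p.μ⟩ ∨
      centralBond c₀ = ⟨p.src, p.ν⟩)
    {α : ℝ} (hα : ∀ i', dist1 (loopHol U c₀ i') ≤ α) (κ : ℝ)
    (hκ : κ = ((Fintype.card (Idx P) : ℝ))⁻¹ *
      ((Finset.univ.filter fun i' : Idx P => (stairWord i'.2.1 (off i'.1)).head? = some (ν, true)).card : ℝ))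
    (hA : α < 1 / 24) (hC : α < deltaSU (Fin 2) / 2) (hD : 800 * (((P.d + 2) * P.L : ℕ) : ℝ) * α < κ)
    {ε : ℝ} (hε : 0 < ε) :
    ∃ η : ℝ, 0 < η ∧ ∀ x : Matrix.specialUnitaryGroup (Fin 2) ℂ,
      dist1 (x * (GaugeField.plaqHol U p)⁻¹) < η →
        ∃ U' : GaugeField P j (Matrix.specialUnitaryGroup (Fin 2) ℂ),
          (∀ b, ‖((U' b : Matrix.specialUnitaryGroup (Fin 2) ℂ) : Matrix (Fin 2) (Fin 2) ℂ) - (U b : Matrix (Fin 2) (Fin 2) ℂ)‖ < ε) ∧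
          avgFun (expMeanLogSU (n := Fin 2)) U' = avgFun (expMeanLogSU (n := Fin 2)) U ∧ GaugeField.plaqHol U' p = x :=
  by
  classical
  exact plaqHol_fibre_locally_onto hj hδ hτ U hU c₀ hν p hβ (fun c2 h2 => eq_of_centralBond_mem_plaqBonds hj (mem_plaqBonds.2 h2) (mem_plaqBonds.2 hβ))
    (centreLeg_not_mem_edges hj p c₀ hν hβ) hα κ hκ hA hC hD hε

end Summit.QuantumFields.YangMills.Theorems.FluctuationComparisonRegPrIntLS1aCentralEdgeGeometry

end
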